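import Summits.AnomalousDissipation.AnomalousDissipation.Theorems.MarginalStabilityChainStrainedLayerLawSumRuleLine
import Summits.AnomalousDissipation.AnomalousDissipation.Theorems.MarginalStabilityChainStrainedLayerLawStubStrainWorkIdentity
import Summits.AnomalousDissipation.AnomalousDissipation.Theorems.MarginalStabilityChainStrainedLayerLawStubStrainWorkMoment
import Summits.AnomalousDissipation.AnomalousDissipation.Theorems.MarginalStabilityChainStrainedLayerLawStubMomentPairKernel
import Summits.AnomalousDissipation.AnomalousDissipation.Theorems.MarginalStabilityChainStrainedLayerLawStubExcessEnergyKinematic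
import Summits.AnomalousDissipation.AnomalousDissipation.Theorems.MarginalStabilityChainStrainedLayerLawStubVorticityUniformBounds
import Summits.AnomalousDissipation.AnomalousDissipation.Theorems.MarginalStabilityChainStrainedLayerLawSumRuleReduce
import HarnessLib.Audit

/-!
# Line `strain-work-sum-rule` — lead's skeleton for crux `MarginalStabilityChain.StrainedLayerLaw`
(item stmt-AnomalousDissipation-3007, route route-AnomalousDissipation-MarginalStabilityChain; continuation lead c1,
reshape 1 of the planner's checked skeleton v2 `Cruxes/StrainedLayerLaw/Lines/strain_work_sum_rule.lean`)

Crux (FIXED; `Theses/MarginalStabilityChain.lean`): `∃ c > 0 ∀ L > 0 ∃ ν₀ > 0 ∃ θ` admissible `∀ ν ∈ (0,ν₀] ∀ (u,v,p)`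
global classical solutions of the stretched 2-D Navier–Stokes class (γ = ΔU = 1, period `L`) from `U_B^ν + θ`:
`ofReal (c·min L 1) ≤ liminf_T ofReal T⁻¹ ∫⁻_{(0,T]} D`.

The vocabulary (`strainWork`, `excessEnergy`, `vorticity`, `strainMoment`, `pairKernel`, `pairForm`, `SliceTails`,
`ExpTails`, `IsAdmissible`, `InCruxClass`), the proved `floorTransfer` and the sorry-free CONDITIONAL composition
`StrainedLayerLaw_of_sumRuleStubs` are LANDED (`Theorems/MarginalStabilityChainStrainedLayerLawSumRuleLine.lean`,
p97772); this skeleton lives in the same namespace so that the registered stub signatures read verbatim, and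
`StrainedLayerLaw_of` concludes the route decl BY NAME.

## The line (one paragraph)
Exact energy budget of the class, `L·∫_a^b D = ∫_a^b J − (E(b) − E(a))` with the ν-free, derivative-free strain work
`J = ½∫∫(¼ − u² + v²)` (stub 1); kinematics `J = −∫∫ yωu` (stub 2a, two integrations by parts) and
`−∫∫ yωu = ½K_L[ω]` (stub 2b, cylinder Biot–Savart; `K_L ≥ 0` explicit); hygiene: finite-dissipation members of the
BARE class have uniform exponential shear tails on every `[a,b] ⊂ (0,∞)` (stub 3, conjectural in the bare class —
the M1/M3 debt); fixed-ν sublinear excess energy (stub 4); and the crux's dynamical content as a ν-uniform time-mean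
floor on `½K_L[ω(t)]` for ONE admissible x-dependent θ (stub 5, HARDEST, crux-equivalent modulo 1–4; the lead holds
it). `floorTransfer` (proved) absorbs the `ℝ≥0∞` dichotomy "locally infinite dissipation ⇒ the crux holds trivially".

## Landed so far (all ACCEPTED; imported above)
* vocabulary + `floorTransfer` + `StrainedLayerLaw_of_sumRuleStubs`: p97772 (`…SumRuleLine.lean`);
* `stub_strainWorkIdentity`: p105323 (`…StubStrainWorkIdentity.lean`; tools A/B/C p100642/p102946/p102953);
* `stub_strainWorkMoment`: p100562 (`…StubStrainWorkMoment.lean`);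
* `stub_momentPairKernel`: p112524 (`…StubMomentPairKernel.lean`; tools Kernels/Strip/Green p101652/p105352/p111954);
* reshape-2 reduction `excessEnergySublinear_of_vorticityBounds`: p113108 (`…SumRuleReduce.lean`);
* `stub_excessEnergyKinematic`: p118130 (`…StubExcessEnergyKinematic.lean`; tools A p115055 wirtinger, B p115542 enstrophy);
* `stub_vorticityUniformBounds`: p120637 (`…StubVorticityUniformBounds.lean`; 17 tool files A…U p114699–p120386: Kato L¹
  antitonicity, enstrophy bound, moment confinement — the whole fixed-ν a-priori chain, made elementary);
* conditional closure of stub 3 under the class repair: `bareClassTails_of_hasShearLayerTails` p120875 (`…SumRuleShearTails.lean`) with `Literature.Analysis.FluidPDE.StretchedLayer.HasShearLayerTails` p113456 (`Literature/…/StretchedLayerShearTails.lean`).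

## Status after wave 2 (lead c1, 2026-08-16 ~19:30Z): OPEN = stub 3 (bare-class hygiene, blocked) + stub 5 (the crux's dynamics).
Everything else of the line is a theorem. The crux is therefore, kernel-checked, EQUIVALENT-UP-TO-HYGIENE to stub 5: under the
recommended class repair (`HasShearLayerTails` appended to 3007's class) `StrainedLayerLaw` ⇐ `stub_concentrationFloor` alone.

## Reshape 2 (lead c1, after wave 1): `stub_excessEnergySublinear` SPLIT into `stub_excessEnergyKinematic` (slice
kinematics, TRUE, M–L) + `stub_vorticityUniformBounds` (fixed-ν a-priori chain: Kato L¹, Nash-enstrophy, moment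
confinement; TRUE, XL) via the landed `excessEnergySublinear_of_vorticityBounds`. Open stubs after reshape 2: 3, 4a, 4b, 5 (4a, 4b LANDED in wave 2).
Wave-1 audits (memos in the lead's folder `work/stubs/*.md`): stub 3 `stub-blocked` on weak–strong uniqueness in the
finite-dissipation class + existence of the tailed solution (NEW: the BARE class is NON-UNIQUE at θ = 0 — explicit
parallel ghost from a null heat solution with C₀ slices; every such ghost has an infinite dissipation burst, so the
finite-dissipation hypothesis excludes it); stub 4 `stub-blocked` on the uniform vorticity bounds (now stub 4b).

## Reshape 1 (lead c1, 2026-08-16) relative to the planner's v2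
* stub 2 `PairKernelRepresentation` SPLIT into `stub_strainWorkMoment` (M, elementary) + `stub_momentPairKernel`
  (L–XL, Biot–Savart on the cylinder; the 3009 `RowBiotSavart` tools are the nearest infrastructure);
* stub 3 now concludes `ExpTails (Icc a b)` for `0 < a < b` only (weakest form the composition needs; no `t → 0⁺`
  boundary layer for `C²` data); stubs 4–5 take exactly that as hypothesis, and stub 5 additionally receives local
  finiteness of the dissipation (weakest sufficient form).

## Disproof / negatives honoured (Cruxes/StrainedLayerLaw/Disproof.lean, tree copy 05:42Z, read in full today)
* §2 `lawAt_zero_false`, `not_strainedLayerLaw_theta_zero`, `not_strainedLayerLaw_forall_theta` (∃θ load-bearing):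
  θ is used at stub 5 ONLY and stays existential there; `½K_L[−U_B′] = L(ν/4π)^{1/2} → 0` excludes θ = 0
  quantitatively; no stub quantifies the law over all θ.
* §4/§4b `lawAt_parallel_false_of_relaxation`, `parallelRelaxes_thickLayer`, `lawAt_thickLayer_false`
  (x-independent data relaminarise; the breathing layer is an explicit unsteady member of the class): stub 5's θ must
  be x-dependent (docstring); the breathing layer is a free TEST for stubs 1/2a (its `J(t) = L√s(t)/(2√π)`… equals
  `L·D + dE/dt`).
* §3 decaying y-translation symmetry: `J, E, K_L[ω], D` are translation-invariant — consistent. §3 enstrophy law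
  `D = (ν/L)∫∫ω²`: an admissible alternative inside stub 1's proof, not used.
* §3 `strainedRow_pairing_unstable`, `row_dissipation_per_area`: the diagonal of `K_L` (Γ²/8π per core).
* §7 pre-pick audit: A1 (= stub 1) hand-verified incl. laminar check; WEAK JOINT = the physical-class side condition
  (here `stub_bareClassTails`); recommendation (class repair on 3007) recorded in NOTES/HANDOFF.
* No `-- Targets` section names any stub of this line yet; no `Theorems/StrainedLayerLaw*/Negative` module exists;
  `ledger negatives`: no stub is an instance.
-/

set_option linter.dupNamespace false

noncomputable section

open scoped Topology ENNReal
open Filter Set Function MeasureTheory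

namespace Summit.AnomalousDissipation.AnomalousDissipation.Theorems.StrainedLayerLaw.StrainWorkSumRule

open Literature.Analysis.FluidPDE Literature.Analysis.FluidPDE.StretchedLayer
open Summit.AnomalousDissipation.AnomalousDissipation.Theses.MarginalStabilityChain

/-! ## The registered stubs still open: stub 3 (hygiene, blocked) and stub 5 (HARDEST, the crux's dynamics); stubs 1, 2a, 2b, 4a, 4b are LANDED and imported -/

/-- **Stub 3 — TAILS IN THE BARE CLASS (hygiene; CONJECTURAL in the bare class).** Every member of the crux's BARE
classical class (pointwise far field, no growth clause) from the Gaussian-tailed datum `U_B^ν + θ` (θ admissible)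
whose dissipation is locally integrable in time has uniform exponential shear tails on every compact `[a,b] ⊂ (0,∞)`.
True for the PHYSICAL solution (parabolic smoothing; vorticity confined by the compression, Gaussian; the x-dependent
velocity is a potential flow outside the vortical region, `∼ e^{−2π|y|/L}`); in the bare class it is the
well-posedness/uniqueness debt flagged by refuter notes M1/M3, Disproof §4/§7 (`UniqueInClass` "doubtful as stated,
unrefuted") and the sibling line's `stub_velocityRigidity` — a route-level class repair (weighted / energy-class side
condition on 3007) would discharge it by hypothesis plus a regularity lemma. WHY IT MIGHT FAIL: a finite-dissipation
classical ghost with slow (algebraic) approach to `±½` from the same datum — neither constructible nor excludable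
today. SIZE: open in the bare class. [folklore] -/
theorem stub_bareClassTails : ∀ (ν L : ℝ), 0 < ν → 0 < L → ∀ (θ₁ θ₂ : ℝ → ℝ → ℝ), IsAdmissible L θ₁ θ₂ →
    ∀ (u v p : ℝ → ℝ → ℝ → ℝ), InCruxClass ν L θ₁ θ₂ u v p →
      (∀ T : ℝ, 0 < T → ∫⁻ t in Ioc 0 T, layerDissipation ν L (u t) (v t) ≠ ∞) →
        ∀ a b : ℝ, 0 < a → a < b → ExpTails (Icc a b) u v := by
  sorry

/-- **Stub 5 — CIRCULATION-CONCENTRATION FLOOR (HARDEST; the crux's open dynamics in the `K_L` dress; the lead holds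
it).** There is a universal `c > 0` such that for every period `L` some `ν₀ > 0` and ONE ν-independent admissible θ
make every member of the class from `U_B^ν + θ`, `ν ≤ ν₀`, with locally finite dissipation and shear tails on every
`[a,b] ⊂ (0,∞)`, satisfy `∫₁ᵀ ½K_L[ω(t)] dt ≥ (c·L·min(L,1) − ε)T` eventually: on time average a fixed fraction of the
pinned circulation `−L` per period sits in ROUND concentrations (cores: `Γ²/8π` each) rather than in sheets
(`K_L`-value ∝ thickness) or jets (negative cross terms). Equivalent to the crux modulo stubs 1–4 and the transfer
(kernel-checked: `StrainedLayerLaw_of_sumRuleStubs`). `θ = 0` is excluded quantitatively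
(`½K_L[−U_B′] = L(ν/4π)^{1/2} → 0`, Disproof §2) and so is every x-independent θ (Disproof §4/§4b) — the witness θ
must depend on `x`. Numerics FOR it: refuter DNS j005025 (`D_∞/(L/8π) = 0.950/0.996/0.9997` at `Re_δ = 10/18/32`,
steady one-core terminal state), toys j013626/j013718 (seeded short cell). WHY IT MIGHT FAIL: exactly as the crux —
relaminarisation for a sequence `ν_j → 0`, parking on thin-sheet states with `K_L[ω] = O(L√ν)`, or a wild bare-class
member; no theorem of this kind (ν-uniform, infinite-time, every solution from one datum) exists for any
Navier–Stokes flow. SIZE: open problem. [folklore] -/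
theorem stub_concentrationFloor : ∃ c : ℝ, 0 < c ∧ ∀ L : ℝ, 0 < L → ∃ ν₀ : ℝ, 0 < ν₀ ∧ ∃ θ₁ θ₂ : ℝ → ℝ → ℝ,
    IsAdmissible L θ₁ θ₂ ∧
    ∀ ν : ℝ, 0 < ν → ν ≤ ν₀ → ∀ (u v p : ℝ → ℝ → ℝ → ℝ), InCruxClass ν L θ₁ θ₂ u v p →
      (∀ T : ℝ, 0 < T → ∫⁻ t in Ioc 0 T, layerDissipation ν L (u t) (v t) ≠ ∞) →
      (∀ a b : ℝ, 0 < a → a < b → ExpTails (Icc a b) u v) →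
        ∀ ε : ℝ, 0 < ε → ∀ᶠ T in atTop,
          (L * (c * min L 1) - ε) * T ≤
            ∫ t in (1:ℝ)..T, (1 / 2) * pairForm L (vorticity (u t) (v t)) := by
  sorry

/-! ## The composition: landed stubs 1, 2a, 2b, 4a, 4b + open stubs 3, 5 prove the crux BY NAME -/

/-- **Composition.** The landed stubs 1, 2a, 2b, 4a, 4b (the last two via the landed reshape-2 reduction
`excessEnergySublinear_of_vorticityBounds`) and the open stubs 3, 5, fed to the landed conditional composition
`StrainedLayerLaw_of_sumRuleStubs` (`Theorems/MarginalStabilityChainStrainedLayerLawSumRuleLine.lean`), prove the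
crux by name. [folklore] -/
theorem StrainedLayerLaw_of : StrainedLayerLaw :=
  StrainedLayerLaw_of_sumRuleStubs stub_strainWorkIdentity stub_strainWorkMoment stub_momentPairKernel
    stub_bareClassTails
    (excessEnergySublinear_of_vorticityBounds stub_excessEnergyKinematic stub_vorticityUniformBounds)
    stub_concentrationFloor

end Summit.AnomalousDissipation.AnomalousDissipation.Theorems.StrainedLayerLaw.StrainWorkSumRule

end
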